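import Summits.BirchSwinnertonDyer.Rank1Residual.ManinAdditive.ShimuraFiveModuli
import Literature.NumberTheory.EllipticCurves.KubertTateFiveVeluKernel
import Literature.NumberTheory.EllipticCurves.IsogenyDescentKummerElement
import Literature.NumberTheory.EllipticCurves.IsogenyDualKernelCyclotomic
import Literature.NumberTheory.EllipticCurves.SelmerCorankProofs
import HarnessLib

/-!
# Road δ, part 7a: the base-point-free relative Kummer lemma (split from es g44's `ManinLocalTwoThreeVeluFiveKummer`)

§1 of es g44's `HOME/es/g44/ManinLocalTwoThreeVeluFiveKummer-es-g44.lean` (sha16 52e17a3e6ffa1e3f) VERBATIM, split off by the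
LEAD prover (p1 gen 23) for the 400-line rule: `exists_pow_mul_eq_of_weilPairing_eq'` — the tree's relative Kummer lemma
`exists_pow_mul_eq_of_weilPairing_eq` WITHOUT its auxiliary rational base point (usable in rank 0): for an `N`-torsion point `T`
with Kummer function `f` and two points `R₁, R₂` whose Galois cocycles lie in `⟨T⟩` and pair equally with `T`, `f(N R₁) = uᴺ f(N R₂)`
for some `u ∈ Fˣ`; and `addOrderOf_toGeomPoints_eq` (the embedding `E(K) ↪ E(K̄)` preserves orders across the classical /
computable `DecidableEq K` leaf).  Consumed by the sibling `ManinLocalTwoThreeVeluFiveKummer.lean` (E-es-242).  No definitions, no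
sorry; nothing about BSD. [cite: SilvermanAEC2009, III.8.1 and X.1.1(c)] [cite: Fisher2001FiveSevenDescent, §1]
-/


set_option linter.dupNamespace false

noncomputable section

open scoped Classical

universe u

namespace Summit.BirchSwinnertonDyer.BirchSwinnertonDyer.Theorems.ManinLocalTwoThree.ShimuraFive

open WeierstrassCurve WeierstrassCurve.geomPoints WeierstrassCurve.Isogeny Field
  Literature.NumberTheory.EllipticCurves Literature.NumberTheory.EllipticCurves.WeierstrassFunctionField
  Literature.NumberTheory.EllipticCurves.KubertTateKummer Literature.NumberTheory.EllipticCurves.KubertTateVelu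
  Summit.BirchSwinnertonDyer.Rank1Residual.ManinAdditive
  Summit.BirchSwinnertonDyer.Rank1Residual.ManinAdditive.EsG43
  Summit.BirchSwinnertonDyer.Rank1Residual.ManinAdditive.EsG44

/-! ## §1 The base-point-free relative Kummer lemma -/

section Kummer

variable {F : Type u} [Field F] {W : WeierstrassCurve F} [W.IsElliptic]
variable {N : ℕ} [Fact N.Prime] [NeZero (N : F)]
variable {T : W.geomPoints} (hT : (N : ℤ) • T = 0)
  (hTfix : ∀ σ : absoluteGaloisGroup F, σ • T = T)
  {f : W.geomFunctionField} (hf0 : f ≠ 0)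
  (hford : ∀ Q : W.geomPoints, ord (W.baseChange (AlgebraicClosure F)).toAffine Q f =
    (N : ℤ) * ((if Q = T then 1 else 0) - (if Q = 0 then 1 else 0)))
include hT hTfix hf0 hford

/-- **Equal cocycles give ratios in `Fˣᴺ`, with no auxiliary rational point.**  Let `div f = N(T) − N(O)` with
`T` a `Γ_F`-fixed `N`-torsion point, and let `R₁, R₂ ∈ E(F̄)` have `N R_i` `Γ_F`-fixed and `∉ {O, T}`.  If the
cocycles agree, `e(σR₁ − R₁, T) = e(σR₂ − R₂, T)` for all `σ`, then **`f(N R₁) = uᴺ · f(N R₂)`** for some `u ∈ Fˣ`.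
(With a Weil function `h` of `T`: `[N]^* f = c hᴺ`, `σ(h(R_i)) = λ_σ e(σR_i − R_i, T) h(R_i)`, so `h(R₁)/h(R₂)` is
fixed, `= u`, and `f(N R_i) = c h(R_i)ᴺ`.)  The tree's `exists_pow_mul_eq_of_weilPairing_eq` assumes in addition a
fixed `Q₀` with `N Q₀ ∉ {O, T}` (a point of infinite order in practice); this version serves curves of rank `0`.
[cite: SilvermanAEC2009, Thm. X.1.1(c) (proof) and Exercise 10.1(c)] -/
theorem exists_pow_mul_eq_of_weilPairing_eq' [CharZero F] {R₁ R₂ : W.geomPoints}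
    (hR₁0 : (N : ℤ) • R₁ ≠ 0) (hR₁T : (N : ℤ) • R₁ ≠ T)
    (hR₁fix : ∀ σ : absoluteGaloisGroup F, σ • ((N : ℤ) • R₁) = (N : ℤ) • R₁)
    (hR₂0 : (N : ℤ) • R₂ ≠ 0) (hR₂T : (N : ℤ) • R₂ ≠ T)
    (hR₂fix : ∀ σ : absoluteGaloisGroup F, σ • ((N : ℤ) • R₂) = (N : ℤ) • R₂)
    (hpair : ∀ σ : absoluteGaloisGroup F,
      weilPairingFun (natCast_level_ne_zero F N) (σ • R₁ - R₁) T =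
        weilPairingFun (natCast_level_ne_zero F N) (σ • R₂ - R₂) T)
    {a₁ a₂ : AlgebraicClosure F} (ha₁ : W.HasValueAt f ((N : ℤ) • R₁) a₁)
    (ha₂ : W.HasValueAt f ((N : ℤ) • R₂) a₂) :
    ∃ u : F, u ≠ 0 ∧ a₁ = algebraMap F (AlgebraicClosure F) u ^ N * a₂ := by
  have hNp : N.Prime := Fact.out
  set hNF := natCast_level_ne_zero F N
  have hNZ : (N : ℤ) ≠ 0 := by exact_mod_cast hNp.ne_zero
  have hNF' : ((N : ℤ) : F) ≠ 0 := by exact_mod_cast hNF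
  -- a Weil function `h` of `T` and `[N]^* f = c · h ^ N`
  set h := weilFn hNF hT with hh_def
  have hh : IsWeilFunction W N T h := isWeilFunction_weilFn hNF hT
  have hh0 : h ≠ 0 := hh.1
  set Fz := (Isogeny.zsmul W (N : ℤ) hNZ).pullbackHom f with hFz
  have hFz0 : Fz ≠ 0 :=
    (map_ne_zero_iff _ (Isogeny.zsmul W (N : ℤ) hNZ).pullbackHom.injective).mpr hf0
  have hhN0 : h ^ N ≠ 0 := pow_ne_zero N hh0
  obtain ⟨c, hc0, hFc⟩ : ∃ c : AlgebraicClosure F, c ≠ 0 ∧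
      Fz = algebraMap (AlgebraicClosure F) W.geomFunctionField c * h ^ N := by
    refine exists_eq_smul_of_ord_eq hhN0 hFz0 fun Q => ?_
    obtain ⟨-, T', hT', hordh⟩ := hh
    rw [ord_pow _ hh0, hFz, ord_pullbackHom_zsmul hNZ hNF' Q f, hford, hordh]
    unfold torsionInd
    rw [smul_sub, hT', sub_eq_zero]
  -- values of `h` at `R₁`, `R₂`
  have hvalF : ∀ {R : W.geomPoints} (_ : (N : ℤ) • R ≠ 0) (_ : (N : ℤ) • R ≠ T)
      {v : AlgebraicClosure F}, W.HasValueAt f ((N : ℤ) • R) v →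
      ∃ w : AlgebraicClosure F, w ≠ 0 ∧ W.HasValueAt h R w ∧ v = c * w ^ N := by
    intro R hR hRT v hv
    obtain ⟨w, hw0, hw⟩ := hh.exists_value hR hRT
    have hR0' : R ≠ 0 := by rintro rfl; exact hR (smul_zero _)
    have h1 : W.HasValueAt Fz R v := hasValueAt_pullbackHom_zsmul hNZ hR hv
    have h2 : W.HasValueAt Fz R (c * w ^ N) := by rw [hFc]; exact (hw.pow N).const_mul c
    exact ⟨w, hw0, hw, h1.unique hR0' h2⟩
  obtain ⟨w₁, hw₁0, hw₁, haw₁⟩ := hvalF hR₁0 hR₁T ha₁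
  obtain ⟨w₂, hw₂0, hw₂, haw₂⟩ := hvalF hR₂0 hR₂T ha₂
  -- `w₁ / w₂` is `Γ_F`-fixed
  have hfix : ∀ σ : absoluteGaloisGroup F, galRingHom σ (w₁ / w₂) = w₁ / w₂ := fun σ ↦ by
    obtain ⟨lam, hlam0, hlam⟩ := hh.exists_galFunctionField_eq σ (hTfix σ)
    have hσR₁ : (N : ℤ) • (σ • R₁ - R₁) = 0 := by rw [smul_sub, smul_comm, hR₁fix σ, sub_self]
    have hσR₂ : (N : ℤ) • (σ • R₂ - R₂) = 0 := by rw [smul_sub, smul_comm, hR₂fix σ, sub_self]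
    have e1 := hh.smul_value hNF hT σ (hTfix σ) hlam hR₁0 hR₁T hσR₁ hw₁
    have e2 := hh.smul_value hNF hT σ (hTfix σ) hlam hR₂0 hR₂T hσR₂ hw₂
    have he0 : weilPairingFun hNF (σ • R₂ - R₂) T ≠ 0 := by
      intro h0
      have h1 := weilPairingFun_pow hNF hσR₂ hT
      rw [h0, zero_pow hNp.ne_zero] at h1
      exact zero_ne_one h1
    rw [map_div₀, e1, e2, hpair σ]
    field_simp
  obtain ⟨u, hu⟩ := exists_algebraMap_of_forall_galRingHom hfix
  refine ⟨u, ?_, ?_⟩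
  · intro hu0
    rw [hu0, map_zero] at hu
    exact div_ne_zero hw₁0 hw₂0 hu.symm
  · have e1 : w₁ = algebraMap F (AlgebraicClosure F) u * w₂ := by
      rw [hu, div_mul_cancel₀ _ hw₂0]
    rw [haw₁, haw₂, e1, mul_pow]
    ring

end Kummer

/-- `ι : E(K) ↪ E(K̄)` preserves orders, across the `DecidableEq K` leaf of the group structure on `E(K)`
(the generic library bakes in the classical instance; over `ℚ` the statement we prove carries the
computable one — the two structures agree by `Subsingleton.elim`). [cite: SilvermanAEC2009, VIII.§1] -/
theorem addOrderOf_toGeomPoints_eq {K : Type*} [Field K] [d : DecidableEq K] (W : WeierstrassCurve K)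
    (P : W.toAffine.Point) : addOrderOf (toGeomPoints W P) = addOrderOf P := by
  have hd : d = fun a b => Classical.propDecidable (a = b) := Subsingleton.elim _ _
  subst hd
  exact addOrderOf_injective (toGeomPoints W) (toGeomPoints_injective W) P


end Summit.BirchSwinnertonDyer.BirchSwinnertonDyer.Theorems.ManinLocalTwoThree.ShimuraFive

end
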